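import Summits.ValiantsHypothesis.ValiantsHypothesis.Theorems.PolyaContinuedSignedCoverLittleEarA
import Mathlib.GroupTheory.Perm.Cycle.Type

/-!
# Route ImmanantSlice — «all cycles even» as an alternating 2-colouring

A `cycleType`-free handle on the coefficient condition of the even-cycle-cover family `D^even`
(crux `EvenCycleDominance`, stmt-ValiantsHypothesis-4211): a fixed-point-free permutation `σ` has all
its cycles of even length iff it admits an ALTERNATING COLOURING `c` (`c (σ x) = ¬ c x` for all `x`).

* `coloring_pow` — an alternating colouring flips along `σ^k` exactly when `k` is odd;
* `even_of_coloring` — (←): going once around a cycle of length `m` returns the colour, so `m` is even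
  (any finite type, no fixed-point hypothesis needed);
* `exists_coloring_of_even` — (→) for derangements of `Fin N`: colour `y` by the parity of its cyclic
  distance (`cdist` of `PolyaContinuedSignedCoverLittleEarA.lean`) from the least point of its cycle;
* `exists_coloring_iff_pow_three` — `σ` has an alternating colouring iff `σ³` has one
  (`c ↦ c`, `c₃ ↦ c₃ ⊕ c₃∘σ ⊕ c₃∘σ²`): the device by which the parity of the survivors of the
  all-ones-return gadget with 3-cycle blocks is read off three disjoint copies of `τ`.

Honest framing: elementary permutation combinatorics; nothing here bears on VP ≠ VNP.
-/

set_option linter.dupNamespace false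

namespace Summit.ValiantsHypothesis.ValiantsHypothesis.Theorems.ImmanantSlice

open Equiv Equiv.Perm Finset
open Summit.ValiantsHypothesis.PolyaContinued

/-- An alternating colouring flips along `σ ^ k` iff `k` is odd. [folklore] -/
theorem coloring_pow {α : Type*} (σ : Perm α) (c : α → Bool) (hc : ∀ x, c (σ x) = !c x)
    (k : ℕ) (x : α) : c ((σ ^ k) x) = (if Odd k then !c x else c x) := by
  induction k with
  | zero => simp
  | succ k ih =>
    rw [pow_succ', Perm.mul_apply, hc, ih]
    by_cases hk : Odd k
    · have : ¬ Odd (k + 1) := fun h => (Nat.odd_add_one.1 h) hk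
      rw [if_pos hk, if_neg this, Bool.not_not]
    · have : Odd (k + 1) := Nat.odd_add_one.2 hk
      rw [if_neg hk, if_pos this]

/-- **(←)** A permutation with an alternating colouring has all its cycles of even length.
[folklore] -/
theorem even_of_coloring {α : Type*} [Fintype α] [DecidableEq α] (σ : Perm α) (c : α → Bool)
    (hc : ∀ x, c (σ x) = !c x) : ∀ m ∈ σ.cycleType, Even m := by
  classical
  intro m hm
  rw [cycleType_def, Multiset.mem_map] at hm
  obtain ⟨g, hg, rfl⟩ := hm
  obtain ⟨hcyc, hagree⟩ := mem_cycleFactorsFinset_iff.1 (Finset.mem_def.2 hg)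
  have hcyc' := hcyc
  obtain ⟨a, ha, -⟩ := hcyc'
  have ha' : a ∈ g.support := Perm.mem_support.2 ha
  -- along the cycle of `a`, `σ` and `g` agree
  have hpow : ∀ k : ℕ, (σ ^ k) a = (g ^ k) a ∧ (g ^ k) a ∈ g.support := by
    intro k
    induction k with
    | zero => exact ⟨rfl, ha'⟩
    | succ k ih =>
      refine ⟨?_, ?_⟩
      · rw [pow_succ', Perm.mul_apply, ih.1, pow_succ', Perm.mul_apply, hagree _ ih.2]
      · rw [pow_succ', Perm.mul_apply, Perm.apply_mem_support]; exact ih.2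
  have horder : (g ^ g.support.card) a = a := by
    rw [← hcyc.orderOf, pow_orderOf_eq_one, Perm.one_apply]
  have h := coloring_pow σ c hc g.support.card a
  rw [(hpow _).1, horder] at h
  by_contra hodd
  simp only [Function.comp_apply, Nat.not_even_iff_odd] at hodd
  rw [if_pos hodd] at h
  cases hca : c a <;> rw [hca] at h <;> simp at h

/-- **(→)** A derangement of `Fin N` all of whose cycles are even admits an alternating colouring:
colour each point by the parity of its cyclic distance from the least point of its cycle.
[folklore] -/
theorem exists_coloring_of_even {N : ℕ} (σ : Perm (Fin N)) (hder : ∀ x, σ x ≠ x)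
    (hall : ∀ m ∈ σ.cycleType, Even m) : ∃ c : Fin N → Bool, ∀ x, c (σ x) = !c x := by
  classical
  have hsupp : ∀ x, x ∈ σ.support := fun x => Perm.mem_support.2 (hder x)
  -- the least point of the cycle of `y`
  let base : Fin N → Fin N := fun y =>
    if h : (σ.cycleOf y).support.Nonempty then (σ.cycleOf y).support.min' h else y
  have hbase_mem : ∀ y, base y ∈ (σ.cycleOf y).support := by
    intro y
    have hne : (σ.cycleOf y).support.Nonempty :=
      ⟨y, mem_support_cycleOf_iff.2 ⟨SameCycle.refl _ _, hsupp y⟩⟩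
    simp only [base, dif_pos hne]
    exact Finset.min'_mem _ _
  refine ⟨fun y => decide (Odd (cdist (σ.cycleOf y) (base y) y)), fun y => ?_⟩
  have hgσ : σ.cycleOf (σ y) = σ.cycleOf y := cycleOf_self_apply σ y
  have hne : (σ.cycleOf y).support.Nonempty :=
    ⟨y, mem_support_cycleOf_iff.2 ⟨SameCycle.refl _ _, hsupp y⟩⟩
  have hbase1 : base (σ y) = (σ.cycleOf y).support.min' hne := by
    simp only [base, hgσ, dif_pos hne]
  have hbase2 : base y = (σ.cycleOf y).support.min' hne := by
    simp only [base, dif_pos hne]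
  have hbase : base (σ y) = base y := hbase1.trans hbase2.symm
  have hgc : (σ.cycleOf y).IsCycle := isCycle_cycleOf σ (hder y)
  have hy : y ∈ (σ.cycleOf y).support := mem_support_cycleOf_iff.2 ⟨SameCycle.refl _ _, hsupp y⟩
  have hb : base y ∈ (σ.cycleOf y).support := hbase_mem y
  have hσy : σ y = σ.cycleOf y y := (cycleOf_apply_self σ y).symm
  have hord : orderOf (σ.cycleOf y) = (σ.cycleOf y).support.card := hgc.orderOf
  have heven : Even (σ.cycleOf y).support.card := by
    refine hall _ ?_
    rw [cycleType_def, Multiset.mem_map]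
    exact ⟨σ.cycleOf y, Finset.mem_def.1 (cycleOf_mem_cycleFactorsFinset_iff.2 (hsupp y)), rfl⟩
  show decide (Odd (cdist (σ.cycleOf (σ y)) (base (σ y)) (σ y))) =
    !decide (Odd (cdist (σ.cycleOf y) (base y) y))
  rw [hgσ, hbase, hσy, cdist_apply_eq hgc hb hy, hord]
  have hd : cdist (σ.cycleOf y) (base y) y < (σ.cycleOf y).support.card :=
    hord ▸ cdist_lt_orderOf hgc hb hy
  rcases Nat.lt_or_ge (cdist (σ.cycleOf y) (base y) y + 1) (σ.cycleOf y).support.card with hlt | hge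
  · rw [Nat.mod_eq_of_lt hlt]
    by_cases hodd : Odd (cdist (σ.cycleOf y) (base y) y)
    · have : ¬ Odd (cdist (σ.cycleOf y) (base y) y + 1) := fun h => (Nat.odd_add_one.1 h) hodd
      simp [hodd, this]
    · have : Odd (cdist (σ.cycleOf y) (base y) y + 1) := Nat.odd_add_one.2 hodd
      simp [hodd, this]
  · have heq : cdist (σ.cycleOf y) (base y) y + 1 = (σ.cycleOf y).support.card := by omega
    rw [heq, Nat.mod_self]
    have hodd : Odd (cdist (σ.cycleOf y) (base y) y) := by
      have h1 : Even (cdist (σ.cycleOf y) (base y) y + 1) := by rw [heq]; exact heven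
      exact Nat.not_even_iff_odd.1 (Nat.even_add_one.1 h1)
    simp [hodd]

/-- For fixed-point-free permutations of `Fin N`: all cycles even iff an alternating colouring exists.
[folklore] -/
theorem even_cycleType_iff_exists_coloring {N : ℕ} (σ : Perm (Fin N)) (hder : ∀ x, σ x ≠ x) :
    (∀ m ∈ σ.cycleType, Even m) ↔ ∃ c : Fin N → Bool, ∀ x, c (σ x) = !c x :=
  ⟨exists_coloring_of_even σ hder, fun ⟨c, hc⟩ => even_of_coloring σ c hc⟩

/-- **`σ` has an alternating colouring iff `σ³` does** (`c ↦ c`; `c₃ ↦ c₃ ⊕ c₃∘σ ⊕ c₃∘σ²`).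
[folklore] -/
theorem exists_coloring_iff_pow_three {α : Type*} (σ : Perm α) :
    (∃ c : α → Bool, ∀ x, c (σ x) = !c x) ↔ ∃ c : α → Bool, ∀ x, c ((σ ^ 3) x) = !c x := by
  constructor
  · rintro ⟨c, hc⟩
    refine ⟨c, fun x => ?_⟩
    rw [coloring_pow σ c hc 3 x, if_pos (by decide)]
  · rintro ⟨c, hc⟩
    refine ⟨fun x => xor (c x) (xor (c (σ x)) (c ((σ ^ 2) x))), fun x => ?_⟩
    have h3 : (σ ^ 3) x = σ ((σ ^ 2) x) := by
      rw [show (3 : ℕ) = 2 + 1 from rfl, pow_succ', Perm.mul_apply]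
    have h2 : (σ ^ 2) x = σ (σ x) := by rw [pow_two, Perm.mul_apply]
    have h2' : (σ ^ 2) (σ x) = σ ((σ ^ 2) x) := by rw [pow_two, Perm.mul_apply, Perm.mul_apply]
    show xor (c (σ x)) (xor (c (σ (σ x))) (c ((σ ^ 2) (σ x)))) =
      !xor (c x) (xor (c (σ x)) (c ((σ ^ 2) x)))
    rw [h2', ← h3, hc x, ← h2]
    cases c x <;> cases c (σ x) <;> cases c ((σ ^ 2) x) <;> rfl

end Summit.ValiantsHypothesis.ValiantsHypothesis.Theorems.ImmanantSlice
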